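import Literature.AnabelianGeometry.SemiGraphs.ProSigmaCompletionQuotients
import HarnessLib

/-!
# Pro-`Σ` completions of discrete groups, II: extension of finite `Σ`-quotients

Continuation of `ProSigmaCompletionQuotients.lean` over abc-iut-L3-t1's interface
`SemiGraphOfAnabelioids.IsProSigmaCompletion Sigma ι` ([SemiAnbd] Example 2.10, "the maximal pro-`Σ`
quotient", p. 31) [cite: MochizukiSemiAnbd2006, Ex. 2.10 p.31].  Theorems only:

* `exists_open_normal_comap_le_ker`: for `U ⊆ P` open (`P` profinite), `Q` a finite group of
  `Σ`-integer order and `f : ι⁻¹(U) → Q`, some open normal `V ⊴ P` has `ι⁻¹(V) ⊆ Ker f` — via the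
  `Σ`-index normal core of part I (the core of `Ker f ∩ ι⁻¹(N)` for an open normal `N ⊆ U`);
* `exists_continuous_extend` (and `_top`): `f` extends to a CONTINUOUS homomorphism `F : U → Q` with
  `F ∘ ι = f`; `continuous_ext_on`: such extensions are unique.

This is the "finite `Σ`-quotients of `ι⁻¹(U)` factor through `U`" half of the statement that `U` is the
pro-`Σ` completion of `ι⁻¹(U)`; it is what the lifting lemma and the slimness engine
(`ProSigmaCompletionLifting.lean`, `ProSigmaCompletionSlim.lean`) consume.  No statement here takes a
side on [IUTchIII] Cor. 3.12; this is plain (pro)finite group theory.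
-/

namespace Literature.AnabelianGeometry.SemiGraphs.SemiGraphOfAnabelioids.IsProSigmaCompletion

open Literature.AnabelianGeometry.Anabelioids Topology

variable {Sigma : Set ℕ} {Γ : Type*} [Group Γ] {P : Type*} [Group P] [TopologicalSpace P]
  {ι : Γ →* P}

section Profinite

variable [IsTopologicalGroup P] [CompactSpace P] [TotallyDisconnectedSpace P]

/-! ### Extension of finite `Σ`-quotients of `ι⁻¹(U)` to `U` -/

/-- **A `Σ`-open normal subgroup of `Γ` below the kernel.**  Let `U ⊆ P` be open, `Q` a finite group of
`Σ`-integer order and `f : ι⁻¹(U) → Q` a homomorphism.  Then there is an open normal subgroup `V ⊴ P`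
whose pull-back `ι⁻¹(V)` lies in `ι⁻¹(U)` and is killed by `f`.
[cite: MochizukiSemiAnbd2006, Ex. 2.10 p.31] -/
theorem exists_open_normal_comap_le_ker (hι : IsProSigmaCompletion Sigma ι) (U : Subgroup P)
    (hU : IsOpen (U : Set P)) {Q : Type*} [Group Q] [Finite Q]
    (hQ : IsSigmaInteger Sigma (Nat.card Q)) (f : U.comap ι →* Q) :
    ∃ V : Subgroup P, IsOpen (V : Set P) ∧ V.Normal ∧
      ∃ hV : V.comap ι ≤ U.comap ι, ∀ γ (hγ : γ ∈ V.comap ι), f ⟨γ, hV hγ⟩ = 1 := by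
  classical
  obtain ⟨N, hNU⟩ := exists_openNormal_le U hU
  haveI : (N : Subgroup P).Normal := N.isNormal'
  -- `A = ι⁻¹(N) ⊴ Γ` of `Σ`-index, inside `U₀ = ι⁻¹(U)`
  set A : Subgroup Γ := (N : Subgroup P).comap ι with hAdef
  haveI hAn : A.Normal := Subgroup.Normal.comap inferInstance ι
  have hA : IsSigmaInteger Sigma A.index := isSigmaInteger_index_comap hι (N : Subgroup P) N.isOpen'
  have hAU : A ≤ U.comap ι := Subgroup.comap_mono hNU
  -- `K = Ker f` as a subgroup of `Γ`, normalised by `U₀`; `K' = K ∩ A`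
  set K : Subgroup Γ := f.ker.map (U.comap ι).subtype with hKdef
  have hKU : K ≤ U.comap ι := by
    rintro _ ⟨x, -, rfl⟩
    exact x.2
  have hKn : ∀ u ∈ U.comap ι, ∀ k ∈ K, u * k * u⁻¹ ∈ K := by
    intro u hu k hk
    obtain ⟨x, hx, rfl⟩ := hk
    have hx' : f x = 1 := hx
    refine ⟨⟨u, hu⟩ * x * ⟨u, hu⟩⁻¹, ?_, rfl⟩
    show f (⟨u, hu⟩ * x * ⟨u, hu⟩⁻¹) = 1
    rw [map_mul, map_mul, hx', mul_one, map_inv, mul_inv_cancel]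
  set K' : Subgroup Γ := K ⊓ A with hK'def
  have hK'A : K' ≤ A := inf_le_right
  have hK'n : ∀ a ∈ A, ∀ k ∈ K', a * k * a⁻¹ ∈ K' := fun a ha k hk =>
    ⟨hKn a (hAU ha) k hk.1, hAn.conj_mem k hk.2 a⟩
  -- `[A : K'] = [A : K ∩ A]` divides `[U₀ : Ker f] = |f(U₀)|`, which divides `|Q|`
  have hK'i : IsSigmaInteger Sigma (K'.relIndex A) := by
    rw [hK'def, Subgroup.inf_relIndex_right]
    refine hQ.of_dvd ?_
    have hA' : (A.subgroupOf (U.comap ι)).map (U.comap ι).subtype = A := by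
      rw [Subgroup.subgroupOf_map_subtype]
      exact inf_eq_left.mpr hAU
    have h1 : K.relIndex A = f.ker.relIndex (A.subgroupOf (U.comap ι)) := by
      have h0 := Subgroup.relIndex_map_map_of_injective f.ker (A.subgroupOf (U.comap ι))
        (U.comap ι).subtype_injective
      rw [hA'] at h0
      rw [hKdef]
      exact h0
    rw [h1]
    refine (Subgroup.relIndex_dvd_index_of_normal _ _).trans ?_
    rw [Subgroup.index_ker]
    exact Subgroup.card_subgroup_dvd_card f.range
  -- the normal core `M` of `K'` has `Σ`-index, so it is the pull-back of an open (normal) `V`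
  have hM : IsSigmaInteger Sigma K'.normalCore.index :=
    isSigmaInteger_index_normalCore A hA K' hK'A hK'n hK'i
  obtain ⟨V, hVo, hVM⟩ := hι.comap_surj K'.normalCore inferInstance hM
  have hVn : V.Normal := normal_of_comap_normal hι V hVo (hVM ▸ inferInstance)
  have hVU : V.comap ι ≤ U.comap ι := by
    rw [hVM]
    exact (K'.normalCore_le.trans inf_le_left).trans hKU
  refine ⟨V, hVo, hVn, hVU, ?_⟩
  intro γ hγ
  rw [hVM] at hγ
  have hγK : γ ∈ K := (K'.normalCore_le hγ).1
  obtain ⟨x, hx, hxe⟩ := hγK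
  have hx' : f x = 1 := hx
  have : (⟨γ, hVU (hVM ▸ hγ : γ ∈ V.comap ι)⟩ : U.comap ι) = x := Subtype.ext hxe.symm
  rw [this]
  exact hx'

/-- **Extension of finite `Σ`-quotients.**  Let `U ⊆ P` be an open subgroup of the profinite group `P`,
`Q` a finite group of `Σ`-integer order (discrete), and `f : ι⁻¹(U) → Q` a homomorphism.  Then there
is a CONTINUOUS homomorphism `F : U → Q` extending `f` along `ι`.  (By the previous lemma `f` factors
through `ι⁻¹(U) ↠ U V / V` for an open normal `V ⊴ P`; compose with `U → U V / V`.)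
[cite: MochizukiSemiAnbd2006, Ex. 2.10 p.31] -/
theorem exists_continuous_extend (hι : IsProSigmaCompletion Sigma ι) (U : Subgroup P)
    (hU : IsOpen (U : Set P)) {Q : Type*} [Group Q] [Finite Q] [TopologicalSpace Q]
    [DiscreteTopology Q] (hQ : IsSigmaInteger Sigma (Nat.card Q)) (f : U.comap ι →* Q) :
    ∃ F : U →* Q, Continuous F ∧ ∀ γ (hγ : γ ∈ U.comap ι), F ⟨ι γ, hγ⟩ = f ⟨γ, hγ⟩ := by
  classical
  obtain ⟨V, hVo, hVn, hVU, hVf⟩ := exists_open_normal_comap_le_ker hι U hU hQ f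
  haveI := hVn
  haveI : DiscreteTopology (P ⧸ V) := QuotientGroup.discreteTopology hVo
  -- `ρ : U → P/V` and `ρ₀ : ι⁻¹(U) → P/V` have the same image
  let ρ : U →* P ⧸ V := (QuotientGroup.mk' V).comp U.subtype
  let ρ₀ : U.comap ι →* P ⧸ V := (QuotientGroup.mk' V).comp (ι.comp (U.comap ι).subtype)
  have hρ₀ : ∀ x : U, ρ x ∈ ρ₀.range := by
    rintro ⟨x, hx⟩
    -- the open coset `x (V ∩ U) ⊆ U` meets `ι(Γ)`
    obtain ⟨γ, hγ⟩ := exists_mem_coset hι (V ⊓ U) (hVo.inter hU) x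
    have hγU : ι γ ∈ U := by
      have := U.mul_mem hx (Subgroup.mem_inf.mp hγ).2
      rwa [mul_inv_cancel_left] at this
    refine ⟨⟨γ, hγU⟩, ?_⟩
    change (QuotientGroup.mk (ι γ) : P ⧸ V) = QuotientGroup.mk x
    rw [eq_comm, QuotientGroup.eq]
    exact (Subgroup.mem_inf.mp hγ).1
  have hker : ρ₀.ker ≤ f.ker := by
    rintro ⟨γ, hγ⟩ h
    rw [MonoidHom.mem_ker] at h ⊢
    have hγV : ι γ ∈ V := by
      change (QuotientGroup.mk (ι γ) : P ⧸ V) = 1 at h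
      rwa [QuotientGroup.eq_one_iff] at h
    exact hVf γ hγV
  -- factor `f` through the image of `ρ₀`
  let g : ρ₀.range →* Q :=
    ρ₀.rangeRestrict.liftOfSurjective ρ₀.rangeRestrict_surjective
      ⟨f, by rw [MonoidHom.ker_rangeRestrict]; exact hker⟩
  have hg : ∀ z, g (ρ₀.rangeRestrict z) = f z := fun z =>
    MonoidHom.liftOfRightInverse_comp_apply _ _ _ _ z
  let ρU : U →* ρ₀.range := ρ.codRestrict ρ₀.range hρ₀
  refine ⟨g.comp ρU, ?_, ?_⟩
  · -- continuity: `ρU` is continuous into a discrete space, `g` is continuous from it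
    have hρc : Continuous ρ := by
      change Continuous fun x : U => (QuotientGroup.mk (x : P) : P ⧸ V)
      exact QuotientGroup.continuous_mk.comp continuous_subtype_val
    have hρUc : Continuous ρU := hρc.subtype_mk _
    have hgc : Continuous g := continuous_of_discreteTopology
    exact hgc.comp hρUc
  · intro γ hγ
    change g (ρU ⟨ι γ, hγ⟩) = f ⟨γ, hγ⟩
    have : ρU ⟨ι γ, hγ⟩ = ρ₀.rangeRestrict ⟨γ, hγ⟩ := Subtype.ext rfl
    rw [this, hg]

/-- Extension of finite `Σ`-quotients of `Γ` itself to `P`: a homomorphism `f : Γ → Q` to a finite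
group of `Σ`-integer order extends to a continuous `F : P → Q` with `F ∘ ι = f`.
[cite: MochizukiSemiAnbd2006, Ex. 2.10 p.31] -/
theorem exists_continuous_extend_top (hι : IsProSigmaCompletion Sigma ι) {Q : Type*} [Group Q]
    [Finite Q] [TopologicalSpace Q] [DiscreteTopology Q] (hQ : IsSigmaInteger Sigma (Nat.card Q))
    (f : Γ →* Q) : ∃ F : P →* Q, Continuous F ∧ ∀ γ, F (ι γ) = f γ := by
  obtain ⟨F, hFc, hF⟩ := exists_continuous_extend hι ⊤ isOpen_univ hQ
    (f.comp ((⊤ : Subgroup P).comap ι).subtype)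
  refine ⟨F.comp (Subgroup.topEquiv.symm.toMonoidHom), hFc.comp ?_, fun γ => ?_⟩
  · exact continuous_id.subtype_mk _
  · change F ⟨ι γ, trivial⟩ = f γ
    exact hF γ trivial

omit [IsTopologicalGroup P] [CompactSpace P] [TotallyDisconnectedSpace P] in
/-- Uniqueness of continuous extensions: two continuous maps `U → Q` (`Q` Hausdorff) that agree on
`ι(ι⁻¹ U)` are equal, for `U ⊆ P` open. [cite: MochizukiSemiAnbd2006, Ex. 2.10 p.31] -/
theorem continuous_ext_on (hι : IsProSigmaCompletion Sigma ι) (U : Subgroup P)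
    (hU : IsOpen (U : Set P)) {Q : Type*} [TopologicalSpace Q] [T2Space Q]
    {F F' : U → Q} (hF : Continuous F) (hF' : Continuous F')
    (h : ∀ γ (hγ : γ ∈ U.comap ι), F ⟨ι γ, hγ⟩ = F' ⟨ι γ, hγ⟩) : F = F' := by
  have hd : Dense {u : U | (u : P) ∈ ι '' (U.comap ι : Set Γ)} := by
    intro x
    rw [IsInducing.subtypeVal.closure_eq_preimage_closure_image, Set.mem_preimage]
    refine closure_mono ?_ (le_closure_image_comap hι U hU x.2)
    rintro _ ⟨γ, hγ, rfl⟩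
    exact ⟨⟨ι γ, hγ⟩, ⟨γ, hγ, rfl⟩, rfl⟩
  refine Continuous.ext_on hd hF hF' ?_
  rintro ⟨x, hx⟩ ⟨γ, hγ, hγx⟩
  subst hγx
  exact h γ hγ

end Profinite

end Literature.AnabelianGeometry.SemiGraphs.SemiGraphOfAnabelioids.IsProSigmaCompletion
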